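import Mathlib
import Summits.Ventures.HodgeRepro2.T5AdicCompletionMap

/-!
# THE TAME / WILD DICTIONARY: `IsUnit (2 : O_{K_v}) ↔ 2 ∉ v` (T5TameDictionary)

The chain's tame-case hypothesis `IsUnit (2 : O_{K_v})` (rows 141–144 / 151 / 156 / 169's `normCharConductor_eq_one_of_isUnit_two`)
and its wild-case negation (row 169's `two_le_normCharConductor_of_not_isUnit_two`, row 176) are read off the GLOBAL
place: `2` is a unit of `O_{K_v}` iff `v ∤ 2`, i.e. `(2 : 𝓞_K) ∉ v.asIdeal` — «the residue characteristic of `v` is odd»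
in the print's words (README §10.5(i)). Proof: the valuation of a global integer on the completion is its `v`-adic
valuation (`valuedAdicCompletion_eq_valuation`), `≤ 1` always and `< 1` exactly on `v` (`intValuation_lt_one_iff_mem`),
and a local integer is a unit iff its valuation is `1` (`adicCompletionIntegers.isUnit_iff_valued_eq_one`).

No axiom beyond the standard trio; nothing of the scored record changes.
§8(d): uses an L-value-free non-vanishing device: NO.
-/

namespace Summit.Ventures.HodgeRepro2.T5TameDictionary

open IsDedekindDomain HeightOneSpectrum NumberField

variable {K : Type*} [Field K] [NumberField K] (v : HeightOneSpectrum (NumberField.RingOfIntegers K))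

/-- The valuation on `K_v` of a global integer `r` is `v.intValuation r`. -/
theorem val_algebraMap_ringOfIntegers (r : NumberField.RingOfIntegers K) :
    Valued.v ((algebraMap (NumberField.RingOfIntegers K) (v.adicCompletionIntegers K) r :
      v.adicCompletionIntegers K) : v.adicCompletion K) = v.intValuation r := by
  have e := IsDedekindDomain.HeightOneSpectrum.valuedAdicCompletion_eq_valuation (K := K) v r
  rw [IsDedekindDomain.HeightOneSpectrum.valuation_of_algebraMap] at e
  rw [← e]
  rfl

/-- A global integer is a unit of `O_{K_v}` iff it is not in `v`. -/
theorem isUnit_algebraMap_iff (r : NumberField.RingOfIntegers K) :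
    IsUnit (algebraMap (NumberField.RingOfIntegers K) (v.adicCompletionIntegers K) r) ↔ r ∉ v.asIdeal := by
  rw [IsDedekindDomain.HeightOneSpectrum.adicCompletionIntegers.isUnit_iff_valued_eq_one]
  change Valued.v ((algebraMap (NumberField.RingOfIntegers K) (v.adicCompletionIntegers K) r :
    v.adicCompletionIntegers K) : v.adicCompletion K) = 1 ↔ _
  rw [val_algebraMap_ringOfIntegers, ← IsDedekindDomain.HeightOneSpectrum.intValuation_lt_one_iff_mem, not_lt]
  exact ⟨fun h => h.ge, fun h => le_antisymm (IsDedekindDomain.HeightOneSpectrum.intValuation_le_one v r) h⟩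

/-- THE TAME DICTIONARY: `2` is a unit of `O_{K_v}` iff `v ∤ 2`. -/
theorem isUnit_two_iff : IsUnit (2 : v.adicCompletionIntegers K) ↔ (2 : NumberField.RingOfIntegers K) ∉ v.asIdeal := by
  rw [← isUnit_algebraMap_iff v 2, map_ofNat]

/-- THE WILD DICTIONARY: `2` is not a unit of `O_{K_v}` iff `v ∣ 2`. -/
theorem not_isUnit_two_iff : ¬ IsUnit (2 : v.adicCompletionIntegers K) ↔ (2 : NumberField.RingOfIntegers K) ∈ v.asIdeal := by
  rw [isUnit_two_iff, not_not]

end Summit.Ventures.HodgeRepro2.T5TameDictionary
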